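import Mathlib.MeasureTheory.Measure.Lebesgue.VolumeOfBalls
import Mathlib.MeasureTheory.Measure.Haar.InnerProductSpace
import Mathlib.MeasureTheory.Constructions.Pi
import Mathlib.Analysis.SpecialFunctions.Gamma.BohrMollerup
import Mathlib.Analysis.InnerProductSpace.Projection.Reflection
import HarnessLib

/-!
# The volume of the intersection of two balls (Regev 2004, Claim 3.7)

Topic `Literature/Algebra/EuclideanLattices` (geometry of numbers). Everything in this file is
PROVED (theorems only, no named fact); it is groundwork for the named fact
`Literature.Algebra.EuclideanLattices.usvp_of_dihedralCoset` (Regev 2004, Thm. 1.1, whose §3.3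
"improved algorithm" works with balls because of the `√n` in the following estimate).

**Claim 3.7.** For `R > 0` and `d ∈ ℝⁿ`, the balls `B = B̄(0, R)` and `B' = B̄(d, R)` satisfy
`vol(B ∩ B') / vol(B) ≥ 1 − O(√n ‖d‖ / R)`.  We prove it with the explicit constant `1`:

  `vol B̄(0,R) ≤ vol(B̄(0,R) ∩ B̄(d,R)) + (√n ‖d‖ / R) · vol B̄(0,R)`    (`n ≥ 2`)

(`volume_closedBall_le_volume_inter_add`, real form `sub_mul_volume_closedBall_le_volume_inter`).
The proof is Regev's (p. 10): after a reflection taking `d` to `‖d‖ e₀`, the two "caps"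
`{x ∈ B | x₀ > ‖d‖/2} ⊆ B'` and its mirror image `{x ∈ B' | x₀ < ‖d‖/2} ⊆ B` are disjoint subsets of
`B ∩ B'` of equal volume; a cap is a closed half ball minus the slab `{x ∈ B | 0 ≤ x₀ ≤ ‖d‖/2}`,
which lies in the cylinder `[0, ‖d‖/2] × B̄ⁿ⁻¹(0, R)`; and
`vol B̄ⁿ⁻¹(R) / vol B̄ⁿ(R) = Γ(n/2 + 1) / (√π R Γ((n+1)/2)) ≤ √((n+1)/(2π)) / R ≤ √n / R` by the
log-convexity of `Γ` (Gautschi's inequality `Γ(x + 1/2) ≤ √x Γ(x)`, `gamma_add_half_le_sqrt_mul`).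

## References

* O. Regev, *Quantum computation and lattice problems*, SIAM J. Comput. 33 (2004) 738–760, §3.3,
  Claim 3.7 and its proof (p. 10 of the journal version) [Regev2004].
* E. Artin, *The Gamma Function* (1964), Thm. 2.1 (log-convexity; Mathlib's
  `Real.Gamma_mul_add_mul_le_rpow_Gamma_mul_rpow_Gamma`).
-/

noncomputable section

open MeasureTheory Metric Set WithLp
open scoped ENNReal

namespace Literature.Algebra.EuclideanLattices

/-! ## Gautschi's inequality and the ratio of unit-ball volumes -/

/-- **Gautschi-type inequality** from the log-convexity of `Γ`: `Γ(x + 1/2) ≤ √x · Γ(x)` for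
`x > 0` (`Γ(x + 1/2)² ≤ Γ(x) Γ(x + 1) = x Γ(x)²`). [folklore] -/
theorem gamma_add_half_le_sqrt_mul {x : ℝ} (hx : 0 < x) :
    Real.Gamma (x + 1 / 2) ≤ Real.sqrt x * Real.Gamma x := by
  have h := Real.Gamma_mul_add_mul_le_rpow_Gamma_mul_rpow_Gamma (s := x) (t := x + 1)
    (a := 1 / 2) (b := 1 / 2) hx (by linarith) (by norm_num) (by norm_num) (by norm_num)
  have e1 : 1 / 2 * x + 1 / 2 * (x + 1) = x + 1 / 2 := by ring
  rw [e1, Real.Gamma_add_one hx.ne'] at h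
  have hG : 0 ≤ Real.Gamma x := (Real.Gamma_pos_of_pos hx).le
  calc Real.Gamma (x + 1 / 2)
      ≤ Real.Gamma x ^ (1 / 2 : ℝ) * (x * Real.Gamma x) ^ (1 / 2 : ℝ) := h
    _ = Real.sqrt (Real.Gamma x) * (Real.sqrt x * Real.sqrt (Real.Gamma x)) := by
        rw [← Real.sqrt_eq_rpow, ← Real.sqrt_eq_rpow, Real.sqrt_mul hx.le]
    _ = Real.sqrt x * (Real.sqrt (Real.Gamma x) * Real.sqrt (Real.Gamma x)) := by ring
    _ = Real.sqrt x * Real.Gamma x := by rw [Real.mul_self_sqrt hG]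

/-- The unit-ball constants `κ_k = √πᵏ / Γ(k/2 + 1)` (`vol B̄ᵏ(R) = κ_k Rᵏ`) satisfy
`κ_m ≤ √((m+2)/(2π)) κ_{m+1}`, i.e. `vol B̄ᵐ(R) / vol B̄ᵐ⁺¹(R) ≤ √((m+2)/(2π)) / R`
(Regev: "`vol(B_{n-1})/vol(B_n) = O(√n/R)`"). [cite: Regev2004, Claim 3.7 (proof)] -/
theorem unitBall_coeff_le (m : ℕ) :
    Real.sqrt Real.pi ^ m / Real.Gamma (m / 2 + 1) ≤
      Real.sqrt ((m + 2) / (2 * Real.pi)) *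
        (Real.sqrt Real.pi ^ (m + 1) / Real.Gamma ((m + 1 : ℕ) / 2 + 1)) := by
  have hpi : 0 < Real.pi := Real.pi_pos
  have hx : (0 : ℝ) < m / 2 + 1 := by positivity
  have hg : Real.Gamma ((m + 1 : ℕ) / 2 + 1) ≤ Real.sqrt ((m + 2) / 2) * Real.Gamma (m / 2 + 1) := by
    have h := gamma_add_half_le_sqrt_mul hx
    have e1 : (m : ℝ) / 2 + 1 + 1 / 2 = ((m + 1 : ℕ) : ℝ) / 2 + 1 := by push_cast; ring
    have e2 : (m : ℝ) / 2 + 1 = (m + 2) / 2 := by ring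
    rw [e1] at h
    rw [e2] at h ⊢
    exact h
  have hG1 : 0 < Real.Gamma ((m + 1 : ℕ) / 2 + 1) := Real.Gamma_pos_of_pos (by positivity)
  have hG0 : 0 < Real.Gamma (m / 2 + 1) := Real.Gamma_pos_of_pos hx
  have hs : 0 < Real.sqrt ((m + 2) / 2) := Real.sqrt_pos.2 (by positivity)
  have key : Real.sqrt ((m + 2) / (2 * Real.pi)) * Real.sqrt Real.pi = Real.sqrt ((m + 2) / 2) := by
    rw [← Real.sqrt_mul (by positivity)]
    congr 1
    field_simp
  calc Real.sqrt Real.pi ^ m / Real.Gamma (m / 2 + 1)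
      = (Real.sqrt ((m + 2) / (2 * Real.pi)) * Real.sqrt Real.pi / Real.sqrt ((m + 2) / 2)) *
          (Real.sqrt Real.pi ^ m / Real.Gamma (m / 2 + 1)) := by
        rw [key, div_self hs.ne', one_mul]
    _ = Real.sqrt ((m + 2) / (2 * Real.pi)) *
          (Real.sqrt Real.pi ^ (m + 1) / (Real.sqrt ((m + 2) / 2) * Real.Gamma (m / 2 + 1))) := by
        rw [pow_succ]
        field_simp
    _ ≤ Real.sqrt ((m + 2) / (2 * Real.pi)) *
          (Real.sqrt Real.pi ^ (m + 1) / Real.Gamma ((m + 1 : ℕ) / 2 + 1)) := by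
        gcongr

/-- `vol B̄ᵐ(0, R) · H ≤ (√(m+1) H / R) · vol B̄ᵐ⁺¹(0, R)` for `m ≥ 1`, `R > 0`, `H ≥ 0`: the cylinder
estimate of Regev's proof in the form used below (`√((m+2)/(2π)) ≤ √(m+1)`).
[cite: Regev2004, Claim 3.7 (proof)] -/
theorem ofReal_mul_volume_closedBall_le {m : ℕ} (hm : 1 ≤ m) {R H : ℝ} (hR : 0 < R) (hH : 0 ≤ H) :
    ENNReal.ofReal H * volume (closedBall (0 : EuclideanSpace ℝ (Fin m)) R) ≤
      ENNReal.ofReal (Real.sqrt (m + 1 : ℕ) * H / R) *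
        volume (closedBall (0 : EuclideanSpace ℝ (Fin (m + 1))) R) := by
  haveI : Nonempty (Fin m) := ⟨⟨0, hm⟩⟩
  rw [EuclideanSpace.volume_closedBall, EuclideanSpace.volume_closedBall, Fintype.card_fin,
    Fintype.card_fin]
  set Km : ℝ := Real.sqrt Real.pi ^ m / Real.Gamma (m / 2 + 1) with hKm
  set Kn : ℝ := Real.sqrt Real.pi ^ (m + 1) / Real.Gamma ((m + 1 : ℕ) / 2 + 1) with hKn
  have hKm0 : 0 ≤ Km := by positivity
  have hKn0 : 0 ≤ Kn := by positivity
  have hcoef : Km ≤ Real.sqrt (m + 1 : ℕ) * Kn := by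
    have h1 := unitBall_coeff_le m
    have h2 : Real.sqrt ((m + 2) / (2 * Real.pi)) ≤ Real.sqrt (m + 1 : ℕ) := by
      apply Real.sqrt_le_sqrt
      rw [div_le_iff₀ (by positivity)]
      push_cast
      nlinarith [Real.two_le_pi]
    exact h1.trans (mul_le_mul_of_nonneg_right h2 hKn0)
  rw [← ENNReal.ofReal_pow hR.le, ← ENNReal.ofReal_pow hR.le,
    ← ENNReal.ofReal_mul (pow_nonneg hR.le m), ← ENNReal.ofReal_mul (pow_nonneg hR.le (m + 1)),
    ← ENNReal.ofReal_mul hH,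
    ← ENNReal.ofReal_mul (p := Real.sqrt (m + 1 : ℕ) * H / R) (by positivity)]
  refine ENNReal.ofReal_le_ofReal ?_
  calc H * (R ^ m * Km) ≤ H * (R ^ m * (Real.sqrt (m + 1 : ℕ) * Kn)) := by gcongr
    _ = Real.sqrt (m + 1 : ℕ) * H / R * (R ^ (m + 1) * Kn) := by
        rw [pow_succ]; field_simp

/-! ## Slabs and caps in coordinates -/

section Axis

variable {m : ℕ}

/-- Squared distance to the point `H e₀` on the first axis:
`‖x − H e₀‖² = ‖x‖² − 2 H x₀ + H²`. [folklore] -/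
theorem norm_sub_single_zero_sq (x : EuclideanSpace ℝ (Fin (m + 1))) (H : ℝ) :
    ‖x - EuclideanSpace.single 0 H‖ ^ 2 = ‖x‖ ^ 2 - 2 * H * x 0 + H ^ 2 := by
  rw [norm_sub_sq_real, EuclideanSpace.inner_single_right]
  have h1 : ‖(EuclideanSpace.single (0 : Fin (m + 1)) H : EuclideanSpace ℝ (Fin (m + 1)))‖ = |H| := by
    simp
  rw [h1, sq_abs]
  simp only [RCLike.conj_to_real]
  ring

/-- Coordinate `0` of `H e₀ − x` is `H − x₀`. [folklore] -/
theorem single_zero_sub_apply_zero (x : EuclideanSpace ℝ (Fin (m + 1))) (H : ℝ) :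
    (EuclideanSpace.single 0 H - x : EuclideanSpace ℝ (Fin (m + 1))) 0 = H - x 0 := by
  simp

/-- The coordinate `x ↦ x₀` is measurable. [folklore] -/
theorem measurable_apply_zero : Measurable fun x : EuclideanSpace ℝ (Fin (m + 1)) => x 0 :=
  (PiLp.continuous_apply (p := 2) (β := fun _ : Fin (m + 1) => ℝ) 0).measurable

/-- **The slab lies in a cylinder.**  `vol{x ∈ B̄(0,R) | 0 ≤ x₀ ≤ h} ≤ h · vol B̄ᵐ(0, R)` in
`ℝᵐ⁺¹`, `h ≥ 0`: under the volume-preserving identification `ℝᵐ⁺¹ ≃ ℝ × ℝᵐ` the slab is contained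
in `[0, h] × B̄ᵐ(0, R)`. [cite: Regev2004, Claim 3.7 (proof)] -/
theorem volume_slab_le (R h : ℝ) :
    volume {x : EuclideanSpace ℝ (Fin (m + 1)) | ‖x‖ ≤ R ∧ 0 ≤ x 0 ∧ x 0 ≤ h} ≤
      ENNReal.ofReal h * volume (closedBall (0 : EuclideanSpace ℝ (Fin m)) R) := by
  set Θ : EuclideanSpace ℝ (Fin (m + 1)) → ℝ × (Fin m → ℝ) := fun x =>
    MeasurableEquiv.piFinSuccAbove (fun _ : Fin (m + 1) => ℝ) 0 (ofLp x) with hΘ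
  have hΘmp : MeasurePreserving Θ :=
    (volume_preserving_piFinSuccAbove (fun _ : Fin (m + 1) => ℝ) 0).comp
      (PiLp.volume_preserving_ofLp (Fin (m + 1)))
  set T : Set (Fin m → ℝ) := (toLp 2) ⁻¹' closedBall (0 : EuclideanSpace ℝ (Fin m)) R with hT
  have hTmeas : MeasurableSet T :=
    measurableSet_closedBall.preimage (PiLp.continuous_toLp 2 _).measurable
  have hTvol : volume T = volume (closedBall (0 : EuclideanSpace ℝ (Fin m)) R) :=
    (PiLp.volume_preserving_toLp (Fin m)).measure_preimage
      measurableSet_closedBall.nullMeasurableSet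
  have hsub : {x : EuclideanSpace ℝ (Fin (m + 1)) | ‖x‖ ≤ R ∧ 0 ≤ x 0 ∧ x 0 ≤ h} ⊆
      Θ ⁻¹' (Icc 0 h ×ˢ T) := by
    rintro x ⟨hxR, hx0, hxh⟩
    have hR : 0 ≤ R := (norm_nonneg x).trans hxR
    set y : EuclideanSpace ℝ (Fin m) := toLp 2 fun j : Fin m => x (Fin.succAbove 0 j) with hy
    have hgoal : x ∈ Θ ⁻¹' (Icc 0 h ×ˢ T) ↔ (x 0 ∈ Icc 0 h ∧ y ∈ closedBall (0 : EuclideanSpace ℝ (Fin m)) R) :=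
      Iff.rfl
    rw [hgoal]
    refine ⟨⟨hx0, hxh⟩, ?_⟩
    rw [mem_closedBall, dist_zero_right]
    have h1 : ‖y‖ ^ 2 = ∑ j : Fin m, (x (Fin.succAbove 0 j)) ^ 2 := by
      rw [EuclideanSpace.real_norm_sq_eq]
    have h2 : ‖x‖ ^ 2 = (x 0) ^ 2 + ∑ j : Fin m, (x (Fin.succAbove 0 j)) ^ 2 := by
      rw [EuclideanSpace.real_norm_sq_eq, Fin.sum_univ_succAbove _ 0]
    have h3 : ‖y‖ ^ 2 ≤ R ^ 2 := by
      rw [h1]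
      calc ∑ j : Fin m, (x (Fin.succAbove 0 j)) ^ 2 ≤ ‖x‖ ^ 2 := by
            rw [h2]; linarith [sq_nonneg (x 0)]
        _ ≤ R ^ 2 := by gcongr
    exact (pow_le_pow_iff_left₀ (norm_nonneg _) hR two_ne_zero).1 h3
  calc volume {x : EuclideanSpace ℝ (Fin (m + 1)) | ‖x‖ ≤ R ∧ 0 ≤ x 0 ∧ x 0 ≤ h}
      ≤ volume (Θ ⁻¹' (Icc 0 h ×ˢ T)) := measure_mono hsub
    _ = volume (Icc (0 : ℝ) h ×ˢ T) :=
        hΘmp.measure_preimage (measurableSet_Icc.prod hTmeas).nullMeasurableSet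
    _ = volume (Icc (0 : ℝ) h) * volume T := by rw [Measure.volume_eq_prod, Measure.prod_prod]
    _ = ENNReal.ofReal h * volume (closedBall (0 : EuclideanSpace ℝ (Fin m)) R) := by
        rw [Real.volume_Icc, sub_zero, hTvol]

/-- **Regev's cap argument, on the axis.** For `R > 0`, `H ≥ 0`, `m ≥ 1` and `d₀ = H e₀ ∈ ℝᵐ⁺¹`:
`vol B̄(0,R) ≤ vol(B̄(0,R) ∩ B̄(d₀,R)) + (√(m+1) H / R) vol B̄(0,R)`.
[cite: Regev2004, Claim 3.7 (proof)] -/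
theorem volume_closedBall_le_volume_inter_add_axis (hm : 1 ≤ m) {R H : ℝ} (hR : 0 < R)
    (hH : 0 ≤ H) :
    volume (closedBall (0 : EuclideanSpace ℝ (Fin (m + 1))) R) ≤
      volume (closedBall (0 : EuclideanSpace ℝ (Fin (m + 1))) R ∩
          closedBall (EuclideanSpace.single 0 H) R) +
        ENNReal.ofReal (Real.sqrt (m + 1 : ℕ) * H / R) *
          volume (closedBall (0 : EuclideanSpace ℝ (Fin (m + 1))) R) := by
  -- notation
  set d₀ : EuclideanSpace ℝ (Fin (m + 1)) := EuclideanSpace.single 0 H with hd₀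
  set B : Set (EuclideanSpace ℝ (Fin (m + 1))) := closedBall 0 R with hB
  set B' : Set (EuclideanSpace ℝ (Fin (m + 1))) := closedBall d₀ R with hB'
  have hmeas0 : Measurable fun x : EuclideanSpace ℝ (Fin (m + 1)) => x 0 := measurable_apply_zero
  have hmeasn : Measurable fun x : EuclideanSpace ℝ (Fin (m + 1)) => ‖x‖ := measurable_norm
  -- the pieces
  set A₁ : Set (EuclideanSpace ℝ (Fin (m + 1))) := {x | ‖x‖ ≤ R ∧ H / 2 < x 0} with hA₁
  set ψ : EuclideanSpace ℝ (Fin (m + 1)) → EuclideanSpace ℝ (Fin (m + 1)) :=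
    fun x => d₀ + (LinearIsometryEquiv.neg ℝ (E := EuclideanSpace ℝ (Fin (m + 1)))) x with hψ
  have hψ_apply : ∀ x, ψ x = d₀ - x := fun x => by
    have : ψ x = d₀ + -x := by simp only [hψ, LinearIsometryEquiv.coe_neg]
    rw [this, sub_eq_add_neg]
  have hψmp : MeasurePreserving ψ :=
    (measurePreserving_add_left volume d₀).comp
      (LinearIsometryEquiv.neg ℝ (E := EuclideanSpace ℝ (Fin (m + 1)))).measurePreserving
  set A₂ : Set (EuclideanSpace ℝ (Fin (m + 1))) := ψ ⁻¹' A₁ with hA₂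
  set P : Set (EuclideanSpace ℝ (Fin (m + 1))) := {x | ‖x‖ ≤ R ∧ 0 ≤ x 0} with hP
  set N : Set (EuclideanSpace ℝ (Fin (m + 1))) := {x | ‖x‖ ≤ R ∧ x 0 ≤ 0} with hN
  set S : Set (EuclideanSpace ℝ (Fin (m + 1))) := {x | ‖x‖ ≤ R ∧ 0 ≤ x 0 ∧ x 0 ≤ H / 2} with hS
  have hA₁meas : MeasurableSet A₁ :=
    (measurableSet_le hmeasn measurable_const).inter (measurableSet_lt measurable_const hmeas0)
  have hA₂meas : MeasurableSet A₂ := hA₁meas.preimage hψmp.measurable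
  have hPmeas : MeasurableSet P :=
    (measurableSet_le hmeasn measurable_const).inter (measurableSet_le measurable_const hmeas0)
  -- membership in `A₂`
  have hmemA₂ : ∀ x, x ∈ A₂ ↔ ‖d₀ - x‖ ≤ R ∧ x 0 < H / 2 := fun x => by
    rw [hA₂, mem_preimage, hψ_apply]
    change (‖d₀ - x‖ ≤ R ∧ H / 2 < (d₀ - x) 0) ↔ _
    rw [hd₀, single_zero_sub_apply_zero, ← hd₀]
    constructor
    · rintro ⟨h1, h2⟩; exact ⟨h1, by linarith⟩
    · rintro ⟨h1, h2⟩; exact ⟨h1, by linarith⟩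
  -- (1) the caps lie in `B ∩ B'` and are disjoint
  have hA₁sub : A₁ ⊆ B ∩ B' := by
    rintro x ⟨hxR, hx0⟩
    refine ⟨mem_closedBall_zero_iff.2 hxR, ?_⟩
    rw [hB', mem_closedBall, dist_eq_norm, hd₀]
    have h1 : ‖x - EuclideanSpace.single 0 H‖ ^ 2 ≤ ‖x‖ ^ 2 := by
      rw [norm_sub_single_zero_sq]; nlinarith [mul_nonneg hH (sub_nonneg.2 hx0.le)]
    have h2 : ‖x - EuclideanSpace.single 0 H‖ ≤ ‖x‖ :=
      (pow_le_pow_iff_left₀ (norm_nonneg _) (norm_nonneg _) two_ne_zero).1 h1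
    exact h2.trans hxR
  have hA₂sub : A₂ ⊆ B ∩ B' := by
    intro x hx
    obtain ⟨hxR, hx0⟩ := (hmemA₂ x).1 hx
    refine ⟨?_, ?_⟩
    · rw [hB, mem_closedBall_zero_iff]
      have h1 : ‖x‖ ^ 2 ≤ ‖x - EuclideanSpace.single 0 H‖ ^ 2 := by
        rw [norm_sub_single_zero_sq]; nlinarith [mul_nonneg hH (sub_nonneg.2 hx0.le)]
      have h2 : ‖x‖ ≤ ‖x - EuclideanSpace.single 0 H‖ :=
        (pow_le_pow_iff_left₀ (norm_nonneg _) (norm_nonneg _) two_ne_zero).1 h1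
      rw [← hd₀, norm_sub_rev] at h2
      exact h2.trans hxR
    · rw [hB', mem_closedBall, dist_eq_norm, norm_sub_rev]
      exact hxR
  have hdisj : Disjoint A₁ A₂ := by
    rw [Set.disjoint_left]
    rintro x ⟨-, hx1⟩ hx2
    have := ((hmemA₂ x).1 hx2).2
    linarith
  have hI : 2 * volume A₁ ≤ volume (B ∩ B') := by
    have h1 : volume (A₁ ∪ A₂) = volume A₁ + volume A₂ := measure_union hdisj hA₂meas
    have h2 : volume A₂ = volume A₁ := hψmp.measure_preimage hA₁meas.nullMeasurableSet
    calc 2 * volume A₁ = volume A₁ + volume A₂ := by rw [h2, two_mul]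
      _ = volume (A₁ ∪ A₂) := h1.symm
      _ ≤ volume (B ∩ B') := measure_mono (union_subset hA₁sub hA₂sub)
  -- (2) the ball is covered by the two closed half balls, of equal volume
  have hBPN : B ⊆ P ∪ N := by
    intro x hx
    rw [hB, mem_closedBall_zero_iff] at hx
    rcases le_total 0 (x 0) with h | h
    · exact Or.inl ⟨hx, h⟩
    · exact Or.inr ⟨hx, h⟩
  have hNP : volume N = volume P := by
    have hpre : (LinearIsometryEquiv.neg ℝ (E := EuclideanSpace ℝ (Fin (m + 1)))) ⁻¹' P = N := by
      ext x
      simp only [mem_preimage, LinearIsometryEquiv.coe_neg, hP, hN, mem_setOf_eq, norm_neg]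
      simp
    rw [← hpre]
    exact (LinearIsometryEquiv.neg ℝ).measurePreserving.measure_preimage hPmeas.nullMeasurableSet
  have hV : volume B ≤ 2 * volume P := by
    calc volume B ≤ volume (P ∪ N) := measure_mono hBPN
      _ ≤ volume P + volume N := measure_union_le _ _
      _ = 2 * volume P := by rw [hNP, two_mul]
  -- (3) half ball = slab ∪ cap
  have hPSA : P ⊆ S ∪ A₁ := by
    rintro x ⟨hxR, hx0⟩
    rcases le_or_gt (x 0) (H / 2) with h | h
    · exact Or.inl ⟨hxR, hx0, h⟩
    · exact Or.inr ⟨hxR, h⟩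
  have hPle : volume P ≤ volume S + volume A₁ :=
    (measure_mono hPSA).trans (measure_union_le _ _)
  -- (4) slab in a cylinder, (5) cylinder versus ball
  have hSle : volume S ≤ ENNReal.ofReal (H / 2) *
      volume (closedBall (0 : EuclideanSpace ℝ (Fin m)) R) := volume_slab_le R (H / 2)
  have hcyl := ofReal_mul_volume_closedBall_le hm hR hH
  have h2S : 2 * volume S ≤ ENNReal.ofReal (Real.sqrt (m + 1 : ℕ) * H / R) * volume B := by
    calc 2 * volume S ≤ 2 * (ENNReal.ofReal (H / 2) *
          volume (closedBall (0 : EuclideanSpace ℝ (Fin m)) R)) := by gcongr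
      _ = ENNReal.ofReal H * volume (closedBall (0 : EuclideanSpace ℝ (Fin m)) R) := by
          have h2 : (2 : ℝ≥0∞) * ENNReal.ofReal (H / 2) = ENNReal.ofReal H := by
            rw [← ENNReal.ofReal_ofNat 2, ← ENNReal.ofReal_mul (by norm_num)]
            congr 1
            ring
          rw [← mul_assoc, h2]
      _ ≤ _ := hcyl
  -- assembly
  calc volume B ≤ 2 * volume P := hV
    _ ≤ 2 * (volume S + volume A₁) := by gcongr
    _ = 2 * volume S + 2 * volume A₁ := by rw [mul_add]
    _ ≤ ENNReal.ofReal (Real.sqrt (m + 1 : ℕ) * H / R) * volume B + volume (B ∩ B') :=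
        add_le_add h2S hI
    _ = volume (B ∩ B') + ENNReal.ofReal (Real.sqrt (m + 1 : ℕ) * H / R) * volume B := add_comm _ _

/-- **Regev 2004, Claim 3.7** in `ℝᵐ⁺¹`, `m ≥ 1`, for an arbitrary shift `d` (reduced to the axis
case by the reflection taking `d` to `‖d‖ e₀`). [cite: Regev2004, Claim 3.7] -/
theorem volume_closedBall_le_volume_inter_add_succ (hm : 1 ≤ m) {R : ℝ} (hR : 0 < R)
    (d : EuclideanSpace ℝ (Fin (m + 1))) :
    volume (closedBall (0 : EuclideanSpace ℝ (Fin (m + 1))) R) ≤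
      volume (closedBall (0 : EuclideanSpace ℝ (Fin (m + 1))) R ∩ closedBall d R) +
        ENNReal.ofReal (Real.sqrt (m + 1 : ℕ) * ‖d‖ / R) *
          volume (closedBall (0 : EuclideanSpace ℝ (Fin (m + 1))) R) := by
  set d₀ : EuclideanSpace ℝ (Fin (m + 1)) := EuclideanSpace.single 0 ‖d‖ with hd₀
  have hnorm : ‖d‖ = ‖d₀‖ := by simp [hd₀]
  have key := volume_closedBall_le_volume_inter_add_axis hm hR (norm_nonneg d)
  suffices hI : volume (closedBall (0 : EuclideanSpace ℝ (Fin (m + 1))) R ∩ closedBall d R) =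
      volume (closedBall (0 : EuclideanSpace ℝ (Fin (m + 1))) R ∩ closedBall d₀ R) by
    rw [hI]; exact key
  by_cases hdd : d = d₀
  · rw [← hdd]
  · set Φ := (Submodule.span ℝ {d - d₀})ᗮ.reflection with hΦ
    have hΦd : Φ d = d₀ := Submodule.reflection_sub hnorm
    have hΦd₀ : Φ d₀ = d := by rw [← hΦd, hΦ, Submodule.reflection_reflection]
    have hpre : Φ ⁻¹' (closedBall 0 R ∩ closedBall d₀ R) = closedBall 0 R ∩ closedBall d R := by
      rw [Set.preimage_inter, LinearIsometryEquiv.preimage_closedBall,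
        LinearIsometryEquiv.preimage_closedBall, hΦ, Submodule.reflection_symm, map_zero, ← hΦ,
        hΦd₀]
    rw [← hpre]
    exact Φ.measurePreserving.measure_preimage
      (measurableSet_closedBall.inter measurableSet_closedBall).nullMeasurableSet

end Axis

/-! ## Claim 3.7 in dimension `n ≥ 2` -/

/-- **Regev 2004, Claim 3.7** (volume form, explicit constant).  For `n ≥ 2`, `R > 0` and any
`d ∈ ℝⁿ`: `vol B̄(0,R) ≤ vol(B̄(0,R) ∩ B̄(d,R)) + (√n ‖d‖ / R) · vol B̄(0,R)`, i.e. the relative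
volume of the intersection of a ball with its translate by `d` is at least `1 − √n ‖d‖/R`.
[cite: Regev2004, Claim 3.7] -/
theorem volume_closedBall_le_volume_inter_add {n : ℕ} (hn : 2 ≤ n) {R : ℝ} (hR : 0 < R)
    (d : EuclideanSpace ℝ (Fin n)) :
    volume (closedBall (0 : EuclideanSpace ℝ (Fin n)) R) ≤
      volume (closedBall (0 : EuclideanSpace ℝ (Fin n)) R ∩ closedBall d R) +
        ENNReal.ofReal (Real.sqrt n * ‖d‖ / R) *
          volume (closedBall (0 : EuclideanSpace ℝ (Fin n)) R) := by
  obtain ⟨m, rfl⟩ : ∃ m, n = m + 1 := ⟨n - 1, by omega⟩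
  exact volume_closedBall_le_volume_inter_add_succ (by omega) hR d

/-- **Regev 2004, Claim 3.7** (real form): for `n ≥ 2`, `R > 0`, `d ∈ ℝⁿ`,
`(1 − √n ‖d‖ / R) · vol B̄(0,R) ≤ vol(B̄(0,R) ∩ B̄(d,R))`. [cite: Regev2004, Claim 3.7] -/
theorem sub_mul_volume_closedBall_le_volume_inter {n : ℕ} (hn : 2 ≤ n) {R : ℝ} (hR : 0 < R)
    (d : EuclideanSpace ℝ (Fin n)) :
    (1 - Real.sqrt n * ‖d‖ / R) * volume.real (closedBall (0 : EuclideanSpace ℝ (Fin n)) R) ≤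
      volume.real (closedBall (0 : EuclideanSpace ℝ (Fin n)) R ∩ closedBall d R) := by
  have h := volume_closedBall_le_volume_inter_add hn hR d
  have hVtop : volume (closedBall (0 : EuclideanSpace ℝ (Fin n)) R) ≠ ⊤ :=
    measure_closedBall_lt_top.ne
  have hItop : volume (closedBall (0 : EuclideanSpace ℝ (Fin n)) R ∩ closedBall d R) ≠ ⊤ :=
    (measure_mono Set.inter_subset_left |>.trans_lt measure_closedBall_lt_top).ne
  have hc : 0 ≤ Real.sqrt n * ‖d‖ / R := by positivity
  have h' := ENNReal.toReal_mono (ENNReal.add_ne_top.2 ⟨hItop, ENNReal.mul_ne_top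
    ENNReal.ofReal_ne_top hVtop⟩) h
  rw [ENNReal.toReal_add hItop (ENNReal.mul_ne_top ENNReal.ofReal_ne_top hVtop),
    ENNReal.toReal_mul, ENNReal.toReal_ofReal hc] at h'
  simp only [measureReal_def]
  nlinarith [h', ENNReal.toReal_nonneg (a := volume (closedBall (0 : EuclideanSpace ℝ (Fin n)) R))]

end Literature.Algebra.EuclideanLattices
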